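import Summits.QuantumFields.BalabanUV.T4Continuum.Support.BoundaryRateLayeredWordShapes

/-!
# BoundaryRateLayeredWordPrinted (part 3 of 3 of the layered word frame) — END TO END ON THE PRINTED RADIUS FACTORS, ONE WORD PER
LAYER: the layered fit at the letter-core radii of the printed radii, `MarginCauchy` (`c₀ = 2`), `CollarDecay`, and collar §12's
`FluctDampedOne` with the profile `layeredSigma (lwCarriers 𝔸 k N) (16·s/β) δ 2` (`ρ = 2`); non-vacuity and the NEGATIVE CONTROL
(no layered word domain about the trivial background is convex) (tree target `Summits/QuantumFields/BalabanUV/T4Continuum/Support/`;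
cell `pub-balaban`, spine estimate NE5, boundary-functional member, lineage t4-ne5-p3 gen 13; imports part 2
`BoundaryRateLayeredWordShapes` ONLY — part 1's module docstring carries the HONEST FRAMING, the print CONTEXT and the ABSOLUTE RULE
governing this part verbatim; [folklore], 0 sorry, every located input a binder.)

HONEST FRAMING (short form; part 1 in full).  Rung (B)+1 bookkeeping on a FIXED finite torus — NOT infinite volume, NOT a mass gap,
NOT Clay.  `T4BoundaryCarrier.NE5B` is NOT PRINTED and is not re-filed, re-worded or weakened here.  THIS IS A TOY: the «printed
radius factors» are the typed numbers `B14Radii.shrink β p = 1 − β(1 − 2^{−p})` of [III] (2.34) used as COEFFICIENTS of a toy word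
constraint per layer; nothing of Bałaban's spaces (2.34)–(2.39) (averaged configurations, nonlinear in 𝐔, a covariant derivative; ONE
run) is encoded, and whether print's margins survive there is decided nowhere.  NOT summit progress.

CONTENT [folklore] / [bookkeeping].  §(f) `lwPrintedGap` (the circles' room: a QUARTER of the printed radius difference, in the layer
unit `a·α`), `lwPrintedGap_pos`, the arithmetic `log_room` (`0 ≤ r₀ < r_X ≤ r_Y ≤ 1 ⇒ (r_Y − r_X)/2 ≤ log(1 + (r_Y − r₀)) − log(1 + (r_X − r₀))`:
the convex letter cores of §13k keep HALF of the difference of the word radii), `lwPrinted_fits` (the layered fit `LWordFits` at the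
core radii `lcoreR u k (printedR a β α)` for `a·α ≤ 1`, `δ ≤ ½`, `s ≤ β/4`, background words within every printed radius),
`lwPrinted_hr_one`, `lwPrinted_marginCauchy`, `lwPrinted_fluctDampedOne` (`FluctDampedOne` through collar §12g's
`fluctDampedOne_of_collar_normalized` with unit `a/4`, `ρ = 2`, `ε = a·s`, hence `s ≤ β/16` and the profile constant `16·s/β`),
`lwPrinted_fluctDampedOne_one` (trivial background: numerical hypotheses only, jointly satisfiable with print's `β = 1/4`);
§(g) `lwPrinted_nonvacuous`, `single_layer_preimage`, `lwdom_one_not_convex` (pull-back along the layer-`0` injection to the Word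
leaf's `wdom_one_not_convex`: §12h's `framePath_of_convex` does not apply to layered word domains; §13i's device is what part 2's
`lw_framePath` uses).

ABSOLUTE RULE.  [folklore] kernel mathematics only; no `sorry`, no axiom beyond the standard triple, no hypothesis of statement type;
print in docstrings as CONTEXT only ([III] = [Balaban1988Convergent] p. 261 (2.34) *"|∂U − 1|, |∂𝐔 − 1| < (1 − β(1 − 2^{−(j−n)}))α_{0,n}ξ²(Lⁿξ)^{−2}"*,
p. 277 the powers-of-1/2 sentence; [I] = [Balaban1987RG1] (3.14)–(3.17) p. 272–273 — spans certified in the lineage's cross-reads);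
nothing of Bałaban's run is derived from print.  Cell record `t4/T4-EST-U3-NE5B-P3.md` §18.
[cite: Balaban1988Convergent, (2.34)–(2.39) p.261, p.277; Balaban1987RG1, (3.14)–(3.17) p.272–273]
-/

namespace Summit.QuantumFields.BalabanUV.T4Continuum.BoundaryRateLayeredWord

open Finset NormedSpace
open Literature.MathematicalPhysics.QuantumFieldTheory.Balaban1983to89
open B7Prop6Bound T4OutputRate T4BoundaryCarrier T4BoundaryRate T4BoundaryRateCollar T4BoundaryRateFrame T4BoundaryRateWord

/-! ### §(f) END-TO-END ON THE PRINTED RADIUS FACTORS, ONE WORD PER LAYER: the fit, `MarginCauchy`, `CollarDecay`, `FluctDampedOne` -/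

section PrintedScalar

variable {𝔸 : Type} [NormedRing 𝔸]

/-- THE CIRCLES' ROOM ON THE LAYERED WORD TOY [bookkeeping]: `gap X Y j = (a/4)·(shrink β j − shrink β (X − Y + j))·α(Y − j)` — a
QUARTER of the difference of the printed radii `printedR a β α` (§13e) of the parent and of the step on the layer `Y − j`, in the
layer's coefficient `α`: §12g's normalized gap with unit `a/4` (so `GapShape` with `ρ = 2` EXACTLY).  A quarter, not §13e's half:
the core radii `log(1 + r)` lose at most a factor `2` of the printed differences (`log_room`), and the remaining half is shared by
the path and the circles. [cite: Balaban1988Convergent, (2.34)–(2.39) p.261, p.277; Balaban1987RG1, (3.14)–(3.17) p.272–273] -/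
noncomputable def lwPrintedGap (N : ℕ) (a β : ℝ) (α : ℕ → ℝ) : Fin (N + 1) → Fin (N + 1) → ℕ → ℝ := fun X Y j =>
  a / 4 * (B14Radii.shrink β j - B14Radii.shrink β ((X : ℕ) - Y + j)) * α ((Y : ℕ) - j)

/-- The circles' room is positive for a genuine parent (`Y < X`, `β > 0`) [folklore]. -/
theorem lwPrintedGap_pos (N : ℕ) {a β : ℝ} {α : ℕ → ℝ} (ha : 0 < a) (hβ : 0 < β) (hα : ∀ n, 0 < α n)
    (X Y : Fin (N + 1)) (hYX : Y < X) (j : ℕ) : 0 < lwPrintedGap N a β α X Y j := by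
  have hYX' : (Y : ℕ) < X := hYX
  unfold lwPrintedGap
  refine mul_pos (mul_pos (by positivity) (shrink_sub_shrink_pos hβ ?_)) (hα _)
  omega

/-- **THE ROOM LEFT BY THE LOGARITHM** [folklore]: for `0 ≤ r₀ < r_X ≤ r_Y ≤ 1`,
`(r_Y − r_X)/2 ≤ log(1 + (r_Y − r₀)) − log(1 + (r_X − r₀))` (`log(A/B) ≥ 1 − B/A`, `A ≤ 2`) — the core radii `lcoreR` keep at least
HALF of the difference of the word radii. -/
theorem log_room {r₀ rX rY : ℝ} (h0 : 0 ≤ r₀) (hX : r₀ < rX) (hXY : rX ≤ rY) (hY1 : rY ≤ 1) :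
    (rY - rX) / 2 ≤ Real.log (1 + (rY - r₀)) - Real.log (1 + (rX - r₀)) := by
  set A : ℝ := 1 + (rY - r₀) with hA
  set B : ℝ := 1 + (rX - r₀) with hB
  have hB0 : 0 < B := by rw [hB]; linarith
  have hA0 : 0 < A := by rw [hA]; linarith
  have hA2 : A ≤ 2 := by rw [hA]; linarith
  have h1 : Real.log A - Real.log B = Real.log (A / B) := (Real.log_div hA0.ne' hB0.ne').symm
  have h2 : 1 - B / A ≤ Real.log (A / B) := by
    have h := Real.log_le_sub_one_of_pos (div_pos hB0 hA0)
    rw [Real.log_div hB0.ne' hA0.ne'] at h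
    rw [Real.log_div hA0.ne' hB0.ne']
    linarith
  have h3 : 1 - B / A = (rY - rX) / A := by
    field_simp
    rw [hA, hB]; ring
  have h4 : (rY - rX) / 2 ≤ (rY - rX) / A := div_le_div_of_nonneg_left (by linarith) hA0 hA2
  linarith [h1, h2, h3, h4]

/-- **THE PRINTED RADII FIT, ONE WORD PER LAYER** [folklore]: for `0 < a`, `0 ≤ β ≤ 1`, layer coefficients `α > 0` with `a·α m ≤ 1`
(radii `≤ 1`), `0 ≤ δ ≤ ½`, `0 ≤ s ≤ β/4`, and background words within every printed radius, the layered word fit `LWordFits` holds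
at the CORE radii `lcoreR u k (printedR a β α)` with the layer units `υ m = a·α m` and the circles' quarter `lwPrintedGap`.  Per layer
`m ≤ Y < X`, `k′ = X − m ≥ p + 1`, `p = Y − m`: the logarithm keeps half the printed difference (`log_room`):
`(a·α m/2)(shrink β p − shrink β k′) ≤ ℓ Y m − ℓ X m`; the circles take `(a·α m/4)(…)`; the path's displacement fits in the rest:
`s·δ^{k′} ≤ s·2^{−(p+1)} ≤ (β/4)·2^{−(p+1)} ≤ ¼(shrink β p − shrink β k′)` (the halving `B14Radii.shrink_sub_succ`).  The constant
`s ≤ β/4` is §13e's (`printed_pathFits`).  A toy theorem (CONTEXT quotations only). [cite: Balaban1988Convergent, (2.34)–(2.39) p.261, p.277] -/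
theorem lwPrinted_fits (N : ℕ) {k : ℕ} {a β δ s : ℝ} {α : ℕ → ℝ} {u : ℕ → ℕ → 𝔸} (ha : 0 < a) (hβ : 0 ≤ β)
    (hα : ∀ n, 0 < α n) (hα1 : ∀ n, a * α n ≤ 1) (hδ : 0 ≤ δ) (hδ2 : δ ≤ 1 / 2) (hs0 : 0 ≤ s) (hs : s ≤ β / 4)
    (hr : ∀ j m, ‖oprod (u m) k - 1‖ < printedR a β α j m) :
    LWordFits N (lcoreR u k (printedR a β α)) (fun m => a * α m) δ s (lwPrintedGap N a β α)
      (lcoreR u k (printedR a β α)) := by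
  intro X Y hYX m hmY
  have hYX' : (Y : ℕ) < X := hYX
  have hmY' : (m : ℕ) ≤ Y := hmY
  set p : ℕ := (Y : ℕ) - m with hp
  set k' : ℕ := (X : ℕ) - m with hk'
  have hpk : p + 1 ≤ k' := by omega
  have e1 : (X : ℕ) - Y + ((Y : ℕ) - m) = k' := by omega
  have e2 : (Y : ℕ) - ((Y : ℕ) - m) = (m : ℕ) := by omega
  have hgap : lwPrintedGap N a β α X Y ((Y : ℕ) - m) = a / 4 * (B14Radii.shrink β p - B14Radii.shrink β k') * α m := by
    unfold lwPrintedGap; rw [e1, e2]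
  -- the word radii of the layer `m`
  set r₀ : ℝ := ‖oprod (u m) k - 1‖ with hr₀
  have hrX : printedR a β α X m = a * B14Radii.shrink β k' * α m := rfl
  have hrY : printedR a β α Y m = a * B14Radii.shrink β p * α m := rfl
  have h00 : 0 ≤ r₀ := norm_nonneg _
  have h0X : r₀ < printedR a β α X m := hr X m
  have hsh : B14Radii.shrink β k' ≤ B14Radii.shrink β p := B14Radii.shrink_antitone hβ (by omega)
  have haα : 0 < a * α m := mul_pos ha (hα m)
  have hXY : printedR a β α X m ≤ printedR a β α Y m := by
    rw [hrX, hrY]; nlinarith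
  have hY1 : printedR a β α Y m ≤ 1 := by
    rw [hrY]
    calc a * B14Radii.shrink β p * α m ≤ a * 1 * α m :=
          mul_le_mul_of_nonneg_right (mul_le_mul_of_nonneg_left (B14Radii.shrink_le_one hβ p) ha.le) (hα m).le
      _ ≤ 1 := by rw [mul_one]; exact hα1 m
  have room : (printedR a β α Y m - printedR a β α X m) / 2 ≤
      lcoreR u k (printedR a β α) Y m - lcoreR u k (printedR a β α) X m := by
    rw [lcoreR_eq, lcoreR_eq]
    exact log_room h00 h0X hXY hY1
  -- the path's displacement fits in a quarter of the printed difference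
  have hdiff : B14Radii.shrink β p - B14Radii.shrink β k' = β * ((1 / 2 : ℝ) ^ p - (1 / 2 : ℝ) ^ k') := by
    unfold B14Radii.shrink; ring
  have hδk : δ ^ k' ≤ (1 / 2 : ℝ) ^ k' := pow_le_pow_left₀ hδ hδ2 k'
  have hhk : (1 / 2 : ℝ) ^ k' ≤ (1 / 2 : ℝ) ^ (p + 1) := pow_le_pow_of_le_one (by norm_num) (by norm_num) hpk
  have key : s * δ ^ k' ≤ (B14Radii.shrink β p - B14Radii.shrink β k') / 4 := by
    calc s * δ ^ k' ≤ s * (1 / 2 : ℝ) ^ (p + 1) := mul_le_mul_of_nonneg_left (hδk.trans hhk) hs0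
      _ ≤ β / 4 * (1 / 2 : ℝ) ^ (p + 1) := mul_le_mul_of_nonneg_right hs (by positivity)
      _ = β * ((1 / 2 : ℝ) ^ p - (1 / 2 : ℝ) ^ (p + 1)) / 4 := by rw [pow_succ]; ring
      _ ≤ β * ((1 / 2 : ℝ) ^ p - (1 / 2 : ℝ) ^ k') / 4 := by nlinarith
      _ = (B14Radii.shrink β p - B14Radii.shrink β k') / 4 := by rw [hdiff]
  show lcoreR u k (printedR a β α) X m + a * α m * s * δ ^ ((X : ℕ) - m) + lwPrintedGap N a β α X Y ((Y : ℕ) - m) ≤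
    lcoreR u k (printedR a β α) Y m
  rw [hgap, ← hk']
  have key' : a * α m * s * δ ^ k' ≤ a * α m * ((B14Radii.shrink β p - B14Radii.shrink β k') / 4) := by
    rw [mul_assoc (a * α m)]; exact mul_le_mul_of_nonneg_left key haα.le
  rw [hrX, hrY] at room
  nlinarith [room, key']

/-- THE TRIVIAL BACKGROUND MEETS EVERY PRINTED RADIUS [folklore]: letters `u ≡ 1` give the word `1` (`oprod_one`), within every
positive printed radius (`printedR_pos`, `β < 1`; print: `β = 1/4`). -/
theorem lwPrinted_hr_one (k : ℕ) {a β : ℝ} {α : ℕ → ℝ} (ha : 0 < a) (hβ : 0 ≤ β) (hβ1 : β < 1) (hα : ∀ n, 0 < α n)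
    (j m : ℕ) : ‖oprod (fun _ => (1 : 𝔸)) k - 1‖ < printedR a β α j m := by
  rw [oprod_one, sub_self, norm_zero]
  exact printedR_pos ha hβ hβ1 hα j m

end PrintedScalar

section PrintedHook

variable {𝔸 : Type} [NormedRing 𝔸] [NormedAlgebra ℂ 𝔸] [CompleteSpace 𝔸] [NormOneClass 𝔸]

/-- `MarginCauchy` (`c₀ = 2`) ON THE PRINTED RADII, ONE WORD PER LAYER [folklore]: `lw_marginCauchy` with `lwPrinted_fits` and the
positive quarter rooms. -/
theorem lwPrinted_marginCauchy (N : ℕ) {k : ℕ} {a β δ s : ℝ} {α : ℕ → ℝ} {u : ℕ → ℕ → 𝔸} (ha : 0 < a) (hβ : 0 < β)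
    (hα : ∀ n, 0 < α n) (hα1 : ∀ n, a * α n ≤ 1) (hδ : 0 ≤ δ) (hδ2 : δ ≤ 1 / 2) (hs0 : 0 ≤ s)
    (hs : s ≤ β / 4) (hu : ∀ m i, ‖u m i‖ ≤ 1) (hr : ∀ j m, ‖oprod (u m) k - 1‖ < printedR a β α j m)
    (W : Set (ℕ → ℝ)) (κ : ℝ) :
    MarginCauchy (lwGeneration 𝔸 k N) (lwChart 𝔸 k N (lcoreR u k (printedR a β α)) (fun m => a * α m) δ s) W κ
      (LwAdmT k N u (printedR a β α)) (lwGauge 𝔸 k N) (lwPrintedGap N a β α) 2 :=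
  lw_marginCauchy k N hu hr (fun m => (mul_pos ha (hα m)).le) hδ hs0
    (fun X Y hYX j => lwPrintedGap_pos N ha hβ hα X Y hYX j) (lwPrinted_fits N ha hβ.le hα hα1 hδ hδ2 hs0 hs hr) W κ

/-- **END-TO-END ON THE PRINTED RADIUS FACTORS, ONE WORD CONSTRAINT PER LAYER IN NON-COMMUTING LETTERS** [folklore]: for `0 < a`,
`0 < β ≤ 1`, layer coefficients `α > 0` with `a·α ≤ 1`, `0 ≤ δ ≤ ½`, `0 ≤ s ≤ β/16`, background letters of norm `≤ 1` whose words are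
within every printed radius, the layered word toy satisfies §10's `FluctDampedOne` (parent module) for the tables analytic on the
LAYERED WORD DOMAINS, with the layered profile `layeredSigma (lwCarriers 𝔸 k N) (16·s/β) δ 2` — THROUGH §12g's
`fluctDampedOne_of_collar_normalized` (unit `a/4`, `ρ = 2` EXACTLY, smallness `2·(a s) ≤ (a/4)β/2`, i.e. `s ≤ β/16`) from
`lwPrinted_marginCauchy` (whose (F-P) is DERIVED through the convex layered letter cores inside the NON-CONVEX layered word domains,
`lwdom_one_not_convex`) and `lwPrinted_collarDecay`.  What this certifies: §12's three binders `MarginCauchy`, `GapShape`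
(layer-dependent coefficients, the printed factors) and `CollarDecay` are JOINTLY INHABITED by an encoding whose analyticity domains
are WORD constraints in non-commuting letters, one per layer, and the machine runs end to end on them — the combination §13e
(layers, commuting scalars) and §13l (words, one idle layer) each have half of.  It certifies NOTHING about Bałaban's objects; whether
print's margins survive for the spaces (2.34)–(2.39) is decided nowhere; `NE5B` stays NOT PRINTED. -/
theorem lwPrinted_fluctDampedOne (N : ℕ) {k : ℕ} {a β δ s : ℝ} {α : ℕ → ℝ} {u : ℕ → ℕ → 𝔸} (ha : 0 < a) (hβ : 0 < β)
    (hα : ∀ n, 0 < α n) (hα1 : ∀ n, a * α n ≤ 1) (hδ : 0 ≤ δ) (hδ2 : δ ≤ 1 / 2) (hs0 : 0 ≤ s)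
    (hs : s ≤ β / 16) (hu : ∀ m i, ‖u m i‖ ≤ 1) (hr : ∀ j m, ‖oprod (u m) k - 1‖ < printedR a β α j m)
    (W : Set (ℕ → ℝ)) (κ : ℝ) :
    FluctDampedOne (lwGeneration 𝔸 k N) (lwChart 𝔸 k N (lcoreR u k (printedR a β α)) (fun m => a * α m) δ s) W κ
      (LwAdmT k N u (printedR a β α)) (layeredSigma (lwCarriers 𝔸 k N) (16 * s / β) δ 2) := by
  have hs4 : s ≤ β / 4 := by linarith
  have hMC := lwPrinted_marginCauchy N ha hβ hα hα1 hδ hδ2 hs0 hs4 hu hr W κ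
  have hCD : CollarDecay (lwChart 𝔸 k N (lcoreR u k (printedR a β α)) (fun m => a * α m) δ s)
      ((lwGauge 𝔸 k N).rescale α hα) (a * s) δ :=
    lwPrinted_collarDecay k N (lcoreR u k (printedR a β α)) ha.le hα hδ
  have h := fluctDampedOne_of_collar_normalized (a := a / 4) (β := β) hα hMC hCD (by norm_num) (by positivity) hβ
    (by positivity) hδ hδ2 (by nlinarith)
  have hcoef : 2 * (a * s) / (a / 4 * β / 2) = 16 * s / β := by
    field_simp
    ring
  rw [hcoef] at h
  exact h

/-- … so with NO background the END-TO-END statement holds under the numerical hypotheses alone (`0 < a`, `0 < β < 1`, `α > 0`,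
`a·α ≤ 1`, `0 ≤ δ ≤ ½`, `0 ≤ s ≤ β/16`) — jointly satisfiable, e.g. print's `β = 1/4` with `a = 1`, `α ≡ ½`, `δ = ½`, `s = 1/64`.
[folklore] -/
theorem lwPrinted_fluctDampedOne_one (k N : ℕ) {a β δ s : ℝ} {α : ℕ → ℝ} (ha : 0 < a) (hβ : 0 < β) (hβ1 : β < 1)
    (hα : ∀ n, 0 < α n) (hα1 : ∀ n, a * α n ≤ 1) (hδ : 0 ≤ δ) (hδ2 : δ ≤ 1 / 2) (hs0 : 0 ≤ s) (hs : s ≤ β / 16)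
    (W : Set (ℕ → ℝ)) (κ : ℝ) :
    FluctDampedOne (lwGeneration 𝔸 k N)
      (lwChart 𝔸 k N (lcoreR (fun _ _ => (1 : 𝔸)) k (printedR a β α)) (fun m => a * α m) δ s) W κ
      (LwAdmT k N (fun _ _ => (1 : 𝔸)) (printedR a β α)) (layeredSigma (lwCarriers 𝔸 k N) (16 * s / β) δ 2) :=
  lwPrinted_fluctDampedOne N ha hβ hα hα1 hδ hδ2 hs0 hs (fun _ _ => by rw [norm_one])
    (fun j m => lwPrinted_hr_one k ha hβ.le hβ1 hα j m) W κ

/-! ### §(g) Non-vacuity and the negative control: the layered word domains are NOT convex -/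

/-- NON-VACUITY [folklore]: with background words within every radius the core radii are positive, so the trivial layered word `0`
lies in every core of the printed instantiation and in every layered word domain — the binders of `lwPrinted_fluctDampedOne` are
about non-empty sets (and the amplitude `0` is admissible for `s ≥ 0`). -/
theorem lwPrinted_nonvacuous (k N : ℕ) {u : ℕ → ℕ → 𝔸} (hu : ∀ m i, ‖u m i‖ ≤ 1) {r : ℕ → ℕ → ℝ}
    (hr : ∀ j m, ‖oprod (u m) k - 1‖ < r j m) (υ : ℕ → ℝ) (δ s : ℝ) (X : Fin (N + 1)) (i : Fin 2) :
    ((0 : Fin (N + 1) → Fin k → 𝔸), i) ∈ (lwChart 𝔸 k N (lcoreR u k r) υ δ s).core X ∧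
      (0 : Fin (N + 1) → Fin k → 𝔸) ∈ lwdom k N u r X := by
  refine ⟨fun m _ => ?_, fun m _ => ?_⟩
  · show ∑ j, ‖(0 : Fin (N + 1) → Fin k → 𝔸) m j‖ < lcoreR u k r X m
    simpa using lcoreR_pos (hr X m)
  · show seqOf ((0 : Fin (N + 1) → Fin k → 𝔸) m) ∈ wordDom (u m) k (r X m)
    rw [Pi.zero_apply, seqOf_zero]
    exact zero_mem_wordDom (u m) (hu m) k (hr X m)

/-- It pulls the layered word domain (no background) back to §13l's one-word domain of radius `r Y 0` (the other layers carry the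
trivial word `0`, inside every word domain of positive radius). [folklore] -/
theorem single_layer_preimage (k N : ℕ) {r : ℕ → ℕ → ℝ} (hr : ∀ j m, 0 < r j m) (Y : Fin (N + 1)) :
    (fun A : Fin (k + 1) → 𝔸 => (Pi.single (0 : Fin (N + 1)) A : Fin (N + 1) → Fin (k + 1) → 𝔸)) ⁻¹'
        lwdom (k + 1) N (fun _ _ => (1 : 𝔸)) r Y =
      {A : Fin (k + 1) → 𝔸 | seqOf A ∈ wordDom (fun _ => (1 : 𝔸)) (k + 1) (r Y 0)} := by
  ext A
  simp only [Set.mem_preimage, lwdom, Set.mem_setOf_eq]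
  constructor
  · intro h
    simpa using h 0 (Fin.zero_le _)
  · intro h m _
    by_cases hm : m = 0
    · subst hm; simpa using h
    · rw [Pi.single_eq_of_ne hm, seqOf_zero]
      exact zero_mem_wordDom (fun _ => (1 : 𝔸)) (fun _ => by rw [norm_one]) (k + 1) (by
        rw [oprod_one, sub_self, norm_zero]; exact hr Y m)

/-- **THE LAYERED WORD DOMAINS ARE NOT CONVEX** (no background, any number `k + 1 ≥ 1` of letters per layer, any number of layers,
EVERY positive radius table) [folklore]: a convex layered domain would pull back along the layer-`0` injection to a convex one-word
domain, contradicting §13l's `wdom_one_not_convex` — so §12h's `framePath_of_convex` does NOT apply to the layered word encoding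
either, and §13i's device is what `lw_framePath` uses. -/
theorem lwdom_one_not_convex (k N : ℕ) {r : ℕ → ℕ → ℝ} (hr : ∀ j m, 0 < r j m) (Y : Fin (N + 1)) :
    ¬ Convex ℝ (lwdom (k + 1) N (fun _ _ => (1 : 𝔸)) r Y) := by
  intro h
  have h1 := h.is_linear_preimage (isLinearMap_single_layer (𝔸 := 𝔸) (k + 1) N)
  rw [single_layer_preimage k N hr Y] at h1
  exact wdom_one_not_convex k (hr Y 0) h1

end PrintedHook

end Summit.QuantumFields.BalabanUV.T4Continuum.BoundaryRateLayeredWord
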